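import Summits.QuantumFields.BalabanUV.T4Continuum.Support.NE7SliceLinearSplit
import Summits.QuantumFields.BalabanUV.T4Continuum.Support.NE7CornerSpikeTopDictionary
import Summits.QuantumFields.BalabanUV.T4Continuum.Support.NE3SmoothLiftW
import HarnessLib

/-!
# Support | NE7 (gen 97, ROAD-G97 §4 S3 — THE LINEAR SPLIT WITH CORNER SPIKES, EXACT): for every skew periodic `X` in the tower class, with `f := framePotW L (k+1) W X` and the
# corner spikes `S := gaugeDir W (spikeW M f)`, the field `Y := X − S` has `D Y = QbarIter L (k+1) W X` EXACTLY (the frame part of the k-fold linearised average is carried by the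
# spikes), and F330's linear split of `Y` gives `X = X_T + X_N`, `X_T ∈ T_♮(W) = frameFreeBlockLandauW`, `X_N = S + rightInvW(QbarIter … X) − gaugeDir W μ`, `μ` corner-trivial

Cell `pub-balaban`, rung (B)+1 sub-cell t4, lineage `b2b-balaban-t4-ne7-p1` (CRUX PROVER NE7 #1 = OWNER of row NE7), generation 97; memo `t4/b2b-balaban-t4-ne7-p1-g97/ROAD-G97.md` §4 S3.
Pure composition of F330 `NE7SliceLinearSplit.exists_linear_split` (gen 95: `Y = Y_T + (rightInvW(D Y) − gaugeDir W μ)`, exact), this generation's `NE7CornerSpikeTopDictionary.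
dirIter_gaugeDir_spikeW` (`D S = gaugeDir W̄ f`, exact, curved), the structure theorem `NE3TangentCovariantTower.dirIter_eq_QbarIter_add_gaugeDir` (`D X = QbarIter X + gaugeDir W̄ (framePotW X)`),
`NE3ResidualSliceRep.dirIter_sub`, and the skewness∕periodicity letters of `framePotW`, `spikeW`, `gaugeDir`.

WHY (memo §§3–4).  On ROAD-Γ′ the representative `X₂` produced by the exact top frame normalisation (S2: `v_top ≡ 1`, hence `logCovIter_top = 0` at the pair) must be split as
`X_T + X_N` with `X_T` EXACTLY in the slice; the only first-kind obstruction in `D X₂` is the top gauge direction `gaugeDir_top(f)` of the second-order frame reading `f`, which must NOT go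
through the right inverse (memo §3(a)) but through the corner spikes (memo §2 (R4); letters `NE7TopFrameReadingSpikeLetters`).  THIS FILE is the exact algebra: after subtracting the
spikes the linearised average of `Y` IS the k-fold linearised double-bar average of `X` (which, at the pair with `v_top ≡ 1`, row NE3's R26′ bounds k-freely: `NE7QbarTopSplitAtPair`
with `gaugeAct 1 D · D⁻¹ = 1`), and F330 does the rest.  The letters of `X_N`'s three pieces are NOT here (spikes: p740779; `rightInvW(QbarIter X)`: (R1)–(R3) + (Γ1); `gaugeDir μ`:
F330 §2 Pythagoras + the (G-ℓ¹) letter).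
WHAT ([folklore]; 0 def, 0 sorry).  §1 `isSkewDir_spikes`, `isPeriodicDir_spikes`, **`dirIter_sub_spikes_eq_QbarIter`** (`D(X − S) = QbarIter L (k+1) W X`).
§2 **`exists_split_of_spikes`** (the display: `∃ μ` skew periodic corner-trivial with `(X − S) − rightInvW(D(X − S)) + gaugeDir W μ ∈ frameFreeBlockLandauW L N (k+1) W`).
HONEST FRAMING (page 1): exact lattice algebra over landed kernel theorems; nothing of Bałaban's asserted; S2, the letters of `X_N`, `hdecomp♭`, NE7 NOT proved; spine 0∕9; finite T⁴ rung (B)+1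
— NOT infinite volume, NOT mass gap, NOT `BetaPertH`, NOT Clay.  Continuum YM on T⁴ ⇐ BetaPertH ∧ nine spine estimates (0/9 proved); BetaPertH ⇐ (D1) ∧ (D4) ∧ CAP+tail; G-an2-4
gates asym, D1 and NE2/3/4.
-/

set_option autoImplicit false

open scoped BigOperators Matrix Matrix.Norms.L2Operator
open NormedSpace Finset

namespace Summit.QuantumFields.BalabanUV.T4Continuum.NE7TopNormalisedLinearSplit

open Literature.MathematicalPhysics.QuantumFieldTheory.Balaban1983to89
open B7Prop1Explicit B7Prop2Explicit
open T4AveragingDeficitWall (Ad IsUnitaryCfg IsSkewDir SmallField)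
open T4AveragingDeficitWallBoundary (IsPeriodicCfg periodBox)
open AveragingDeficitPeriodicCounting (IsPeriodicDir)
open AveragingDeficitMultiLevelPrep (cavgIter LevelSmall tower)
open BlockAveragePushDirGauge (gaugeDir isPeriodicDir_gaugeDir)
open NE3TangentCovariantTower (dirIter QbarIter framePotW dirIter_eq_QbarIter_add_gaugeDir)
open NE3FrameFreeSliceW (frameFreeBlockLandauW)
open NE3QbarIterCovLiftPrep (cruxC)
open NE3SmoothRightInverseW (rightInvW)
open NE3EnergyRateWSupRoutePiRInv (dirIter_skew)
open NE3ResidualSliceRep (dirIter_sub)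
open NE3CornerSpikes (spikeW spikeW_mem_skewAdjoint spikeW_add_period)
open NE3LandauOrbit (gaugeDir_skew)
open NE3SmoothLiftW (framePotW_skew framePotW_add_period tower_eq_pow_mul)
open NE7SliceLinearSplit (exists_linear_split)
open NE7CornerSpikeTopDictionary (dirIter_gaugeDir_spikeW)

noncomputable section

variable {d : ℕ} {n : Type*} [Fintype n] [DecidableEq n]

/-! ## §1 The spikes carry the frame part of the k-fold linearised average -/

/-- The corner spikes of the accumulated frame reading are skew (multi-level small-field class, skew `X`). [folklore] -/
theorem isSkewDir_spikes [Nonempty n] {L : ℕ} (hL : 1 ≤ L) (k : ℕ) {W : Site d → Fin d → (Matrix n n ℂ)ˣ} {x : ℝ}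
    (hWu : IsUnitaryCfg W) (hx : 0 ≤ x) (hs : LevelSmall d L k x) (hWx : SmallField W x) {X : Site d → Fin d → Matrix n n ℂ} (hXs : IsSkewDir X) :
    IsSkewDir (gaugeDir W (spikeW (L ^ (k + 1)) (framePotW L (k + 1) W X))) :=
  gaugeDir_skew hWu (spikeW_mem_skewAdjoint _ (framePotW_skew hL k hWu hx hs hWx hXs))

/-- The corner spikes of the accumulated frame reading are `(N·L^{k+1})`-periodic. [folklore] -/
theorem isPeriodicDir_spikes {L N : ℕ} (hL : 1 ≤ L) (k : ℕ) {W : Site d → Fin d → (Matrix n n ℂ)ˣ}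
    (hWP : IsPeriodicCfg W ((N * L ^ (k + 1) : ℕ) : ℤ)) {X : Site d → Fin d → Matrix n n ℂ} (hXP : IsPeriodicDir X ((N * L ^ (k + 1) : ℕ) : ℤ)) :
    IsPeriodicDir (gaugeDir W (spikeW (L ^ (k + 1)) (framePotW L (k + 1) W X))) ((N * L ^ (k + 1) : ℕ) : ℤ) := by
  have hM : 1 ≤ L ^ (k + 1) := Nat.one_le_pow _ L (by omega)
  have hT : ((tower L N (k + 1) : ℕ) : ℤ) = ((N * L ^ (k + 1) : ℕ) : ℤ) := by rw [tower_eq_pow_mul, Nat.mul_comm]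
  have hWPt : IsPeriodicCfg W ((tower L N (k + 1) : ℕ) : ℤ) := by rw [hT]; exact hWP
  have hXPt : IsPeriodicDir X ((tower L N (k + 1) : ℕ) : ℤ) := by rw [hT]; exact hXP
  have hfP : ∀ (z : Site d) (τ : Fin d), framePotW L (k + 1) W X (z + (N : ℤ) • e τ) = framePotW L (k + 1) W X z :=
    framePotW_add_period L k hWPt hXPt
  have hsP : ∀ (y : Site d) (τ : Fin d), spikeW (L ^ (k + 1)) (framePotW L (k + 1) W X) (y + ((L ^ (k + 1) * N : ℕ) : ℤ) • e τ)
      = spikeW (L ^ (k + 1)) (framePotW L (k + 1) W X) y := spikeW_add_period hM hfP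
  have hMN : ((L ^ (k + 1) * N : ℕ) : ℤ) = ((N * L ^ (k + 1) : ℕ) : ℤ) := by rw [Nat.mul_comm]
  rw [hMN] at hsP
  exact isPeriodicDir_gaugeDir hWP hsP

/-- **THE SPIKES CARRY THE FRAME PART OF THE k-FOLD LINEARISED AVERAGE, EXACTLY**: in the multi-level small-field class at a unitary `W` of period `N·L^{k+1}`, for a skew periodic `X`,
with `f := framePotW L (k+1) W X` and `S := gaugeDir W (spikeW L^{k+1} f)`: `dirIter L (k+1) W (X − S) = QbarIter L (k+1) W X` (`D X = QbarIter X + gaugeDir W̄ f` and `D S = gaugeDir W̄ f`).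
[folklore] -/
theorem dirIter_sub_spikes_eq_QbarIter [Nonempty n] {L N : ℕ} [NeZero N] (hL : 1 ≤ L) (k : ℕ) {W : Site d → Fin d → (Matrix n n ℂ)ˣ} {x : ℝ}
    (hWu : IsUnitaryCfg W) (hWP : IsPeriodicCfg W ((N * L ^ (k + 1) : ℕ) : ℤ)) (hx : 0 ≤ x) (hs : LevelSmall d L k x) (hWx : SmallField W x)
    {X : Site d → Fin d → Matrix n n ℂ} (hXs : IsSkewDir X) (hXP : IsPeriodicDir X ((N * L ^ (k + 1) : ℕ) : ℤ)) :
    dirIter L (k + 1) W (fun y μ => X y μ - gaugeDir W (spikeW (L ^ (k + 1)) (framePotW L (k + 1) W X)) y μ) = QbarIter L (k + 1) W X := by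
  have hT : ((tower L N (k + 1) : ℕ) : ℤ) = ((N * L ^ (k + 1) : ℕ) : ℤ) := by rw [tower_eq_pow_mul, Nat.mul_comm]
  have hWPt : IsPeriodicCfg W ((tower L N (k + 1) : ℕ) : ℤ) := by rw [hT]; exact hWP
  have hXPt : IsPeriodicDir X ((tower L N (k + 1) : ℕ) : ℤ) := by rw [hT]; exact hXP
  have hfs : ∀ z, framePotW L (k + 1) W X z ∈ skewAdjoint (Matrix n n ℂ) := framePotW_skew hL k hWu hx hs hWx hXs
  have hfP : ∀ (z : Site d) (τ : Fin d), framePotW L (k + 1) W X (z + (N : ℤ) • e τ) = framePotW L (k + 1) W X z :=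
    framePotW_add_period L k hWPt hXPt
  have h1 := dirIter_eq_QbarIter_add_gaugeDir (M := N) hL k hWu hWPt hx hs hWx hXs hXPt
  have h2 := dirIter_gaugeDir_spikeW (N := N) hL k hWu hWPt hx hs hWx hfs hfP
  rw [dirIter_sub hL k hWu hx hs hWx, h1, h2]
  funext z κ
  exact add_sub_cancel_right _ _

/-! ## §2 The linear split with corner spikes -/

/-- **THE LINEAR SPLIT WITH CORNER SPIKES (ROAD-Γ′ S3), EXACT** (level `k+1`, `M = L^{k+1}`, tower class at `W` of period `N·M`, `2 ≤ L^d`, the right inverse's regime `cruxC·(M²x) < 1`):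
for every skew `(N·M)`-periodic `X`, with `f := framePotW L (k+1) W X`, `S := gaugeDir W (spikeW M f)` and `Y := X − S`, there is a skew periodic CORNER-TRIVIAL `μ` with
`Y − rightInvW(D Y) + gaugeDir W μ ∈ T_♮(W)` — i.e. `X = X_T + X_N`, `X_T ∈ frameFreeBlockLandauW L N (k+1) W`, `X_N = S + rightInvW(D Y) − gaugeDir W μ` — AND `D Y = QbarIter L (k+1) W X`
(§1), so the right inverse is fed the k-fold linearised double-bar average of `X` only. [folklore] -/
theorem exists_split_of_spikes [Nonempty n] {L N : ℕ} [NeZero L] [NeZero N] (hL : 2 ≤ L) (hLd : 2 ≤ L ^ d) (k : ℕ)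
    {W : Site d → Fin d → (Matrix n n ℂ)ˣ} {x : ℝ} (hWu : IsUnitaryCfg W) (hWP : IsPeriodicCfg W ((N * L ^ (k + 1) : ℕ) : ℤ)) (hx : 0 ≤ x)
    (hs : LevelSmall d L k x) (hWx : SmallField W x) (hθ : cruxC d L * (((L : ℝ) ^ (k + 1)) ^ 2 * x) < 1)
    {X : Site d → Fin d → Matrix n n ℂ} (hXs : IsSkewDir X) (hXP : IsPeriodicDir X ((N * L ^ (k + 1) : ℕ) : ℤ)) :
    ∃ (hYs : IsSkewDir (dirIter L (k + 1) W (fun y ν => X y ν - gaugeDir W (spikeW (L ^ (k + 1)) (framePotW L (k + 1) W X)) y ν)))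
      (mu : Site d → Matrix n n ℂ),
      (∀ y, mu y ∈ skewAdjoint (Matrix n n ℂ))
      ∧ (∀ (y : Site d) (i : Fin d), mu (y + ((N * L ^ (k + 1) : ℕ) : ℤ) • e i) = mu y)
      ∧ (∀ w : Site d, mu (((L : ℤ) ^ (k + 1)) • w) = 0)
      ∧ (fun y ν => ((X y ν - gaugeDir W (spikeW (L ^ (k + 1)) (framePotW L (k + 1) W X)) y ν)
            - rightInvW hL k hWu hx hs hWx N hθ hYs y ν) + gaugeDir W mu y ν)
          ∈ frameFreeBlockLandauW (d := d) (n := n) L N (k + 1) W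
      ∧ dirIter L (k + 1) W (fun y ν => X y ν - gaugeDir W (spikeW (L ^ (k + 1)) (framePotW L (k + 1) W X)) y ν) = QbarIter L (k + 1) W X := by
  have hL1 : 1 ≤ L := by omega
  -- `Y = X − S` is skew and periodic
  have hSs := isSkewDir_spikes hL1 k hWu hx hs hWx hXs
  have hSP := isPeriodicDir_spikes (N := N) hL1 k hWP hXP
  have hYs : IsSkewDir (fun y ν => X y ν - gaugeDir W (spikeW (L ^ (k + 1)) (framePotW L (k + 1) W X)) y ν) :=
    fun y ν => (skewAdjoint (Matrix n n ℂ)).sub_mem (hXs y ν) (hSs y ν)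
  have hYP : IsPeriodicDir (fun y ν => X y ν - gaugeDir W (spikeW (L ^ (k + 1)) (framePotW L (k + 1) W X)) y ν) ((N * L ^ (k + 1) : ℕ) : ℤ) := by
    intro y i ν; simp only; rw [hXP y i ν, hSP y i ν]
  obtain ⟨mu, hmus, hmuP, hmu0, hmem⟩ := exists_linear_split hL hLd k hWu hWP hx hs hWx hθ hYs hYP
  exact ⟨dirIter_skew hL1 k hWu hx hs hWx hYs, mu, hmus, hmuP, hmu0, hmem, dirIter_sub_spikes_eq_QbarIter hL1 k hWu hWP hx hs hWx hXs hXP⟩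

end

end Summit.QuantumFields.BalabanUV.T4Continuum.NE7TopNormalisedLinearSplit
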